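import Summits.Ventures.YMGap.YM3IR.StrongCouplingCofinal
import Summits.Ventures.YMGap.Thresholds.OneLinkVarianceSDCentred
import HarnessLib

/-!
# YM₃ infrared statement — the STRONG-COUPLING END of the Y4 clustering currency for `SU(3)` RAISED to Wilson
# `|β_W| ≤ 53/100` (tree `|β| ≤ 53/300`) by engine-2's hypothesis-free centred Schwinger–Dyson modulus `K_PV2`

HONEST FRAMING: venture file of the cell `pub-ymgap` (QuantumFields programme; track Y4, seat ym3ir-theory-1; kernel lane, a theorems-only
consumer of tree rows — lead ruling R268 (d)).  Strong-coupling LATTICE statements only: exponential clustering of the finite-volume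
Wilson laws of `SU(3)` lattice gauge theory on the tori `(ℤ/M)³`, uniformly in the side `M ≥ 3`, at SMALL coupling, in track Y4's
currency `YM3IR.UniformClustering` / `YM3IR.LatticeMassGap3Cofinal` (theory-2, `YM3IR/Clustering.lean`, `YM3IR/Statement.lean`).
It does NOT touch the weak-coupling targets (`MassGap3` / `MassGap3Cofinal` need unbounded coupling sets), says nothing about the
continuum, and is not a Clay-problem statement.  THEOREMS ONLY, 0 def, 0 conjecture name, 0 compute; R196: the §Y4 sentences are a
typed INTERFACE whose UV hypothesis is logically idle — this file is the strong-coupling SANITY END of their currency, nothing more.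

WHAT.  ds-1's door `StrongCoupling.uniformClustering_wilson_of_oneLinkKRModulus` (any `d ≥ 2`, `N ≥ 1`: a one-link modulus
`OneLinkKRModulus N R K` on the tilt ball `R ≥ 2(d−1)|β|/N`, `K|β|/N ≤ c̄`, door `P_d(c̄) < 1` ⟹ `UniformClustering` at rate
`κ_d(R_G^{(d)}(c̄))`) FED WITH engine-2 g10's HYPOTHESIS-FREE centred modulus `OneLinkVarianceSDC.su3_oneLinkKRModulus_pv2_of_le`
(`16τ(τ−1) + 9τ³R² ≤ 16(τ−1)K²(1/2 − R)` ⟹ `OneLinkKRModulus 3 R K`; in the tree with `Thresholds/StarSU3PV2DimRows.lean`, whose `d = 3`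
row `su3_three_massGapAt_pv2` is the SAME certificate in the THRESHOLDS currency `MassGapAt 3 3 (β_W/9)`): certificate `R = 53/225`,
`τ = 146/125`, `K = 58823/25000`, `c̄ = 5/36` (`K·53/900 = 0.13856 ≤ 5/36`, `P_3(5/36) = 8c̄² + 6c̄ = 0.9877 < 1`) ⟹
* ★ `uniformClustering_wilsonFamily3_SU3_pv2 (hβ : |β| ≤ 53/300) : UniformClustering suFrobDist (wilsonFamily3 (fundamentalRep (Fin 3)) β)
  (κ_3(R_G^{(3)}(5/36)))` — the `SU(3)` `d = 3` strong-coupling window in Y4's currency moves from Wilson `2/5` (the `N = 3` instance of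
  ds-1's every-`N` `uniformClustering_wilsonFamily3_SU`, 't Hooft `2/45`) to Wilson `53/100`, with the SAME closed-form rate as ds-1's `SU(2)`
  row (`R_G^{(3)}(5/36) = 205/209`, positive: `uniformClustering_wilsonFamily3_SU2_rate_pos`);
* `latticeMassGap3Cofinal_strongCoupling_SU3_pv2 (ha : 0 < a) (hb : b ≤ 53/300)` — theory-2's cofinal TARGET SHAPE on `[a, b]`, as in
  `StrongCouplingCofinal` (`b(β) = 1`, `C_b = 1/a`, `m₀ = m·a`); packaged `exists_…`.
Not claimed: anything at weak coupling; anything for `SU(2)` (ds-1's quarter-modulus row `5/18` = Wilson `5/9` stands) or uniformly in `N`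
(the `N²R²` term of `K_PV2` — every-`N` rows stay Bakry–Émery / star, 't Hooft `2/45`).

References: Osterwalder–Seiler, Ann. Phys. 110 (1978) §3 (strong-coupling clustering in print); H. Shen, R. Zhu, X. Zhu, CMP 400 (2023)
Lemma 4.1 (Bakry–Émery on `SU(N)`); cell files `YM3IR/StrongCoupling.lean` (ds-1), `Thresholds/OneLinkVarianceSDCentred.lean` (engine-2 g10),
`HOME/ym3ir/YM3-IR-theory1.md`.
-/

noncomputable section

open MeasureTheory
open Literature.MathematicalPhysics.QuantumLattice (fundamentalRep)
open Literature.MathematicalPhysics.QuantumFieldTheory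
open Literature.MathematicalPhysics.QuantumFieldTheory.Balaban1983to89.StrongCouplingDobrushinWindow (OneLinkKRModulus)
open Summit.Ventures.YMGap.StarResolventDim (gaugeR doorPoly)
open Summit.Ventures.YMGap.YM3IR.StrongCoupling

namespace Summit.Ventures.YMGap.YM3IR.StrongCouplingSU3PV2

/-- engine-2's `SU(3)` one-link modulus at the `d = 3` certificate point: `OneLinkKRModulus 3 (53/225) (58823/25000)` (`τ = 146/125`),
hypothesis-free (`OneLinkVarianceSDC.su3_oneLinkKRModulus_pv2_of_le`; the certificate inequality is exact rational arithmetic). [folklore] -/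
theorem su3_oneLinkKRModulus_53_225 : OneLinkKRModulus 3 (53 / 225) (58823 / 25000) :=
  Summit.Ventures.YMGap.OneLinkVarianceSDC.su3_oneLinkKRModulus_pv2_of_le (τ := 146 / 125)
    (by norm_num) (by norm_num) (by norm_num) (by norm_num)

/-- **`SU(3)` on `(ℤ/M)³`, two-sided, HYPOTHESIS-FREE, at every tree coupling `|β| ≤ 53/300`** (Wilson `|β_W| = 3|β| ≤ 53/100`; the tilt
`2(d−1)|β|/3 = 4|β|/3 ≤ 53/225` is the modulus radius, `K|β|/3 ≤ 58823/25000 · 53/900 ≤ 5/36`, door `P_3(5/36) < 1`): the `d = 3` Wilson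
laws satisfy `YM3IR.UniformClustering suFrobDist _ m` with `m = κ_3(R_G^{(3)}(5/36))` — the rate of ds-1's `SU(2)` row.  Previous `SU(3)`
window in this currency: `|β| ≤ 6/45` (Wilson `2/5`, `uniformClustering_wilsonFamily3_SU` at `N = 3`). [folklore] -/
theorem uniformClustering_wilsonFamily3_SU3_pv2 {β : ℝ} (hβ : |β| ≤ 53 / 300) :
    YM3IR.UniformClustering suFrobDist (YM3IR.wilsonFamily3 (fundamentalRep (Fin 3)) β)
      ((1 - gaugeR 3 (5 / 36)) ^ 2 / (2 * (2 * gaugeR 3 (5 / 36) * ((2 * 3 : ℕ) : ℝ) + 1))) := by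
  have hR : |β| / (3 : ℕ) * (2 * (((3 : ℕ) : ℝ) - 1)) ≤ 53 / 225 := by push_cast; linarith
  have hc : 58823 / 25000 * (|β| / (3 : ℕ)) ≤ 5 / 36 := by push_cast; linarith
  exact uniformClustering_wilson_of_oneLinkKRModulus (d := 3) (N := 3) (by norm_num) (by norm_num) (by norm_num)
    hR su3_oneLinkKRModulus_53_225 hc (by unfold doorPoly; norm_num)

/-- Packaged: `∃ m > 0, UniformClustering suFrobDist (wilsonFamily3 (fundamentalRep (Fin 3)) β) m` at every `|β| ≤ 53/300`. [folklore] -/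
theorem exists_uniformClustering_wilsonFamily3_SU3_pv2 {β : ℝ} (hβ : |β| ≤ 53 / 300) :
    ∃ m : ℝ, 0 < m ∧ YM3IR.UniformClustering suFrobDist (YM3IR.wilsonFamily3 (fundamentalRep (Fin 3)) β) m :=
  ⟨_, uniformClustering_wilsonFamily3_SU2_rate_pos, uniformClustering_wilsonFamily3_SU3_pv2 hβ⟩

/-- **The cofinal TARGET SHAPE on a compact strong-coupling interval, `SU(3)`**: for `0 < a` and `b ≤ 53/300` (Wilson `β_W ≤ 53/100`),
`LatticeMassGap3Cofinal [a, b] suFrobDist (fundamentalRep (Fin 3)) (m·a) (1/a)` with `m = κ_3(R_G^{(3)}(5/36))` — block length `1 ≤ β/a`,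
all tori of side `M ≥ 3`, rate `m a/β ≤ m` (the shape of `StrongCouplingCofinal.latticeMassGap3Cofinal_strongCoupling_SU2`).  Non-vacuity of
the target's shape; NOTHING at weak coupling (`MassGap3Cofinal` needs `¬ BddAbove I`). [folklore] -/
theorem latticeMassGap3Cofinal_strongCoupling_SU3_pv2 {a b : ℝ} (ha : 0 < a) (hb : b ≤ 53 / 300) :
    YM3IR.LatticeMassGap3Cofinal (Set.Icc a b) suFrobDist (fundamentalRep (Fin 3))
      ((1 - gaugeR 3 (5 / 36)) ^ 2 / (2 * (2 * gaugeR 3 (5 / 36) * ((2 * 3 : ℕ) : ℝ) + 1)) * a) (1 / a) := by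
  intro β hβ
  obtain ⟨haβ, hβb⟩ := hβ
  have hβ0 : 0 < β := lt_of_lt_of_le ha haβ
  have hβabs : |β| ≤ 53 / 300 := by rw [abs_of_pos hβ0]; linarith
  obtain ⟨A, hA⟩ := uniformClustering_wilsonFamily3_SU3_pv2 hβabs
  refine ⟨1, one_pos, ?_, max A 0, fun M _ _ hM => ?_⟩
  · rw [Nat.cast_one, one_div_mul_eq_div, le_div_iff₀ ha, one_mul]; exact haβ
  · have h : YM3IR.ClustersWith suFrobDist (wilsonMeasure (d := 3) (L := M) (fundamentalRep (Fin 3)) β) A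
        ((1 - gaugeR 3 (5 / 36)) ^ 2 / (2 * (2 * gaugeR 3 (5 / 36) * ((2 * 3 : ℕ) : ℝ) + 1))) :=
      hA M (by simpa using hM)
    refine h.mono ?_
    have hm0 := uniformClustering_wilsonFamily3_SU2_rate_pos
    rw [mul_div_assoc]
    refine mul_le_of_le_one_right hm0.le ?_
    rw [div_le_one hβ0]; exact haβ

/-- Packaged: on every compact interval `[a, b] ⊂ (0, 53/300]`, SOME `m₀ > 0` and `C_b` satisfy
`LatticeMassGap3Cofinal [a, b] suFrobDist (fundamentalRep (Fin 3)) m₀ C_b`. [folklore] -/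
theorem exists_latticeMassGap3Cofinal_strongCoupling_SU3_pv2 {a b : ℝ} (ha : 0 < a) (hb : b ≤ 53 / 300) :
    ∃ m₀ : ℝ, 0 < m₀ ∧ ∃ C_b : ℝ,
      YM3IR.LatticeMassGap3Cofinal (Set.Icc a b) suFrobDist (fundamentalRep (Fin 3)) m₀ C_b :=
  ⟨_, mul_pos uniformClustering_wilsonFamily3_SU2_rate_pos ha, _, latticeMassGap3Cofinal_strongCoupling_SU3_pv2 ha hb⟩

end Summit.Ventures.YMGap.YM3IR.StrongCouplingSU3PV2

end
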